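import Summits.QuantumFields.BalabanUV.Beta.RowD1JointEnd

/-!
# `BalabanUV.Beta.MixedWardPacking` — binder row D1, hW side: **THE PACKING ADAPTER FROM A BOND-LEVEL WARD LAW OF an1's MIXED TABLE
# TO THE hW END's LEVEL-0 MIXED WARD LETTER (W-M₀)** at the literal of record (β sub-cell, row BETA-an2 = BINDER-OWNERS row D1 OWNER, an2 gen 21, K-W1)

HONEST FRAMING (cell charter, verbatim): «discharging BetaPertH makes Balaban's UV stability UNCONDITIONAL — a real
constructive-QFT result; it is NOT the continuum limit and NOT the Clay problem.»
HONEST DEPENDENCY: continuum YM on T⁴ ⇐ BetaPertH ∧ nine spine estimates (0/9 proved); BetaPertH ⇐ (D1) ∧ (D4) ∧ CAP+tail;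
G-an2-4 gates asym, D1 and NE2/3/4.
DERIVED cell leaf ([folklore] kernel bookkeeping; [our object] three definitions = NAMES for displayed kernels).  No statement of Bałaban's papers,
no `[cite:]`, no `Prop` fact is minted.  CONDITIONAL WIRING: the bond-level Ward law (WM-bond) below is a HYPOTHESIS (exact-ℚ toy evidence ENGINE-W(owner),
journal X-an2-52 — NOT a theorem of the tree); this file REPACKS it into the binder `hM₂0` (+ `hclsW₀`, `hRW₀p`) of `RowD1JointEnd.symmetries_JsRowD1_of_letters`
with an EXPLICIT residual `RWof`.  Discharges NO letter; 0∕4 binders (hW, hR, D1Tel, D1Rep); NOT D1, NOT `BetaPertH`, NOT continuum, NOT Clay.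

WHAT (`d + 1 = 4`, centred root `ρ_c = toSite (ctrOff 4 Lc)`, any `cΛ`; the Ward letter is leaf-06's `WardLocusParityLevels.…_TW_su_exact₀` binder `hM₂0`
at `mixFF := mixFFAt ρ_c Lc`):
* §1 [our object] `wardM Lc y ρ′ w` := the letter's LEFT side (block divergence of `M2Of 3 Lc (mixFFAt ρ_c Lc) 0` over `B(y)`, prefactor
  `(stepScale 0·Lc⁴)⁻¹`), `datM Lc cΛ y ρ′ w` := its commutator datum `[M1At … cΛ 0 ρ′ w, diagK D_y]`, **`RWof Lc cΛ y ρ′ w := wardM − datM`** (the residual the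
  letter FORCES), and `wardMixed_RWof` : the letter `hM₂0` holds for `RW₀ := RWof Lc cΛ` BY DEFINITION (its content moves into the class and parity of `RWof`).
* §2 entrywise forms: `wardM_inl_inl` (`= Lc⁻⁴·Σ_{v,κ} (t − t)` over an1's `mixKerAt`), `datM_inl_inl` (`= cΛ·hessKerAt·(D(x′) − D(x))`, `D := ½Σ_v legInd`), and the
  vanishing of both off the field–field block.
* §3 **`parityOdd_RWof_of_bondLaw`**: the bond-level law **(WM-bond)** — «the `f ↔ f′`-SYMMETRIC part of `Lc⁻⁴·Σ_{u∈B(y)}Σ_κ (t_{(ρ′,w)}(f,f′;(κ,u−e_κ)) −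
  t_{(ρ′,w)}(f,f′;(κ,u)))` equals `cΛ·h_{(ρ′,w)}(f,f′)·(D_y(x_{f′}) − D_y(x_f))`» — gives `trK (RWof …) = −sgnK (RWof …)` (row-parity-odd; `hessKerAt` is antisymmetric).
* §4 **`vertexFamily_RWof`** (NO hypothesis): `∃ C δ > 0, ∀ y, VertexFamily (RWof Lc cΛ y) Lc C δ` — from an1's `biLoc_mixFFAt`∕`biLoc_hessFFAt` (finite-range tables),
  re-centred at the coarse point (`biLoc_absorb`) and summed over the block.
* §5 **`mixedWardBinders_of_bondLaw`**: (WM-bond) ⟹ the three mixed Ward binders (`hclsW₀`, `hRW₀p`, `hM₂0`) of `symmetries_JsRowD1_of_letters` with `RW₀ := RWof Lc cΛ`.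
* §6 **`symmetries_JsRowD1Pin_of_letters_bondWard`**: hW ∧ hR for `JsRowD1Pin` ⟸ hM ∧ hInv ∧ hBord0 ∧ hBord0″ ∧ (WM-bond) (the packed binders ARE the END's, verbatim).
Provenance: β sub-cell, unit beta-an2 gen 21, 2026-08-20 (v1); no existing file touched.
-/

open Finset
open scoped BigOperators
open Literature.MathematicalPhysics.QuantumFieldTheory
open Literature.MathematicalPhysics.QuantumFieldTheory.Balaban1983to89
open Literature.MathematicalPhysics.QuantumFieldTheory.Balaban1983to89.Beta
open B12Sec2to5 (l1 l1_nonneg)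
open B6BondElimination (unitVec)
open ExpKernelCalculus (MKer BiLoc VertexFamily comp shiftK l1_sub_triangle l1_sub_symm)
open KernelWard (divV)
open AffineAveraging (box toSite)
open AveragingContoursRooted (ctr ctrOff ctrOff_mem_box)
open AveragingHessianKernels (ell)
open AveragingHessianKernelsRooted (hessFFAt hessKerAt hessKerAt_swap hessFFAt_inl_inl hessFFAt_inl_inr hessFFAt_inr biLoc_hessFFAt)
open AveragingMixedJetTables (mixFFAt mixKerAt mixAbs mixAbs_nonneg mixFFAt_inl_inl mixFFAt_inl_inr mixFFAt_inr biLoc_mixFFAt)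
open OneStepResolventKernel (Fib biLoc_finset_sum)
open KernelWard (biLoc_add biLoc_sub)
open StepJetData (biLoc_weaken biLoc_smul)
open BalabanStepW2 (M2Of wM1 wM2)
open Summit.QuantumFields.BalabanUV.Beta.TameKernelCalculus
open Summit.QuantumFields.BalabanUV.Beta.BorderedHessian (diagK diagK_apply comp_diagK_left comp_diagK_right stepScale sgnK sgnK_apply sgnF)
open Summit.QuantumFields.BalabanUV.Beta.AveragingWardRootedStencils (legInd legInd_apply legInd_inl)
open Summit.QuantumFields.BalabanUV.Beta.SpineRooted (M1At)
open Summit.QuantumFields.BalabanUV.Beta.WardLocusStencils (divV_apply)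
open Summit.QuantumFields.BalabanUV.Beta.WardLocusParityLevels (M2Of_apply)
open AveragingHessianKernelsRooted (vhSAt linKerAt)
open PolarizationSign (reflSign WardTransversal AxisReflectionCovariant)
open KernelReflection (refK)
open ResolventReflection (bref Φ)
open OneStepKernelFamily (TbalOf flipK)
open BalabanStepJetsSucc (wVH)
open Summit.QuantumFields.BalabanUV.Beta.BorderedHessian (ctGen)
open Summit.QuantumFields.BalabanUV.Beta.SecondOrderBorderGauge (actB)
open Summit.QuantumFields.BalabanUV.Beta.SecondOrderBorderModel (Twall)
open Summit.QuantumFields.BalabanUV.Beta.SecondOrderSocketIdentification (vh₂SAn1)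
open Summit.QuantumFields.BalabanUV.Beta.RowD1JointEnd (JsRowD1Pin symmetries_JsRowD1Pin_of_letters)

namespace Summit.QuantumFields.BalabanUV.Beta.MixedWardPacking

noncomputable section

variable {Lc : ℕ} [NeZero Lc]

/-! ## §1 The letter's two sides, the forced residual, and the letter by definition -/

/-- [our object] **THE LEFT SIDE OF (W-M₀) AT an1's MIXED TABLE**: the block divergence (coarse site `y`) of `M2Of 3 Lc (mixFFAt ρ_c Lc) 0 · · ρ′ w`,
prefactor `(stepScale 0 · Lc⁴)⁻¹` — verbatim the binder's left side. -/
def wardM (Lc : ℕ) [NeZero Lc] (y : Fin (3 + 1) → ℤ) (ρ' : Fin (3 + 1)) (w : Fin (3 + 1) → ℤ) : MKer (3 + 1) (Fib 3) :=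
  (stepScale 3 Lc 0 * (Lc : ℝ) ^ (3 + 1))⁻¹ •
    ∑ v ∈ box (3 + 1) Lc, divV (fun κ u => M2Of 3 Lc (mixFFAt (toSite (ctrOff 4 Lc)) Lc) 0 κ u ρ' w) ((Lc : ℤ) • y + toSite v)

/-- [our object] **THE COMMUTATOR DATUM OF (W-M₀)**: `[M1At 3 Lc ρ_c cΛ 0 ρ′ w, diagK (½ Σ_v legInd ρ_c (Lc•y + v))]` — verbatim the binder's datum. -/
def datM (Lc : ℕ) [NeZero Lc] (cΛ : ℝ) (y : Fin (3 + 1) → ℤ) (ρ' : Fin (3 + 1)) (w : Fin (3 + 1) → ℤ) : MKer (3 + 1) (Fib 3) :=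
  comp (M1At 3 Lc (toSite (ctrOff 4 Lc)) cΛ 0 ρ' w)
      (diagK (((1 : ℝ) / 2) • ∑ v ∈ box (3 + 1) Lc, legInd (toSite (ctrOff 4 Lc)) ((Lc : ℤ) • y + toSite v)))
    - comp (diagK (((1 : ℝ) / 2) • ∑ v ∈ box (3 + 1) Lc, legInd (toSite (ctrOff 4 Lc)) ((Lc : ℤ) • y + toSite v)))
      (M1At 3 Lc (toSite (ctrOff 4 Lc)) cΛ 0 ρ' w)

/-- [our object] **THE RESIDUAL FORCED BY THE LETTER**: `RWof Lc cΛ y ρ′ w := wardM Lc y ρ′ w − datM Lc cΛ y ρ′ w`. -/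
def RWof (Lc : ℕ) [NeZero Lc] (cΛ : ℝ) : (Fin (3 + 1) → ℤ) → Fin (3 + 1) → (Fin (3 + 1) → ℤ) → MKer (3 + 1) (Fib 3) :=
  fun y ρ' w => wardM Lc y ρ' w - datM Lc cΛ y ρ' w

/-- [folklore] **(W-M₀) HOLDS FOR `RW₀ := RWof Lc cΛ` BY DEFINITION** — the binder `hM₂0` of `RowD1JointEnd.symmetries_JsRowD1_of_letters` VERBATIM
(`mixFF := mixFFAt ρ_c Lc`); its content has moved into the class (§4) and the parity (§3) of `RWof`. -/
theorem wardMixed_RWof (cΛ : ℝ) (y : Fin (3 + 1) → ℤ) (ρ' : Fin (3 + 1)) (w : Fin (3 + 1) → ℤ) :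
    (stepScale 3 Lc 0 * (Lc : ℝ) ^ (3 + 1))⁻¹ • ∑ v ∈ box (3 + 1) Lc,
        divV (fun κ u => M2Of 3 Lc (mixFFAt (toSite (ctrOff 4 Lc)) Lc) 0 κ u ρ' w) ((Lc : ℤ) • y + toSite v) =
      comp (M1At 3 Lc (toSite (ctrOff 4 Lc)) cΛ 0 ρ' w) (diagK (((1 : ℝ) / 2) • ∑ v ∈ box (3 + 1) Lc, legInd (toSite (ctrOff 4 Lc)) ((Lc : ℤ) • y + toSite v)))
        - comp (diagK (((1 : ℝ) / 2) • ∑ v ∈ box (3 + 1) Lc, legInd (toSite (ctrOff 4 Lc)) ((Lc : ℤ) • y + toSite v))) (M1At 3 Lc (toSite (ctrOff 4 Lc)) cΛ 0 ρ' w)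
        + RWof Lc cΛ y ρ' w := by
  show wardM Lc y ρ' w = datM Lc cΛ y ρ' w + (wardM Lc y ρ' w - datM Lc cΛ y ρ' w)
  abel

/-! ## §2 Entrywise forms -/
/-- [folklore] The field–field entries of the left side: `Lc⁻⁴ · Σ_{v,κ} (t_{(ρ′,w)}(f,f′;(κ, s_v − e_κ)) − t_{(ρ′,w)}(f,f′;(κ, s_v)))` over an1's `mixKerAt`
(`stepScale 0 = 1`, `wM2 0 = 1`, `s_v = Lc•y + v`, `f = (β,x)`, `f′ = (β′,x′)`). -/
theorem wardM_inl_inl (y : Fin (3 + 1) → ℤ) (ρ' : Fin (3 + 1)) (w x x' : Fin (3 + 1) → ℤ) (β β' : Fin (3 + 1)) :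
    wardM Lc y ρ' w x x' (Sum.inl β) (Sum.inl β') =
      ((Lc : ℝ) ^ (3 + 1))⁻¹ * ∑ v ∈ box (3 + 1) Lc, ∑ κ : Fin (3 + 1),
        (mixKerAt (toSite (ctrOff 4 Lc)) Lc ρ' w (κ, (Lc : ℤ) • y + toSite v - unitVec κ) (β, x) (β', x')
          - mixKerAt (toSite (ctrOff 4 Lc)) Lc ρ' w (κ, (Lc : ℤ) • y + toSite v) (β, x) (β', x')) := by
  have h1 : stepScale 3 Lc 0 = 1 := by simp [BorderedHessian.stepScale]
  have h2 : wM2 3 Lc 0 = 1 := by simp [BalabanStepW2.wM2]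
  simp only [wardM, h1, one_mul, Pi.smul_apply, Finset.sum_apply, smul_eq_mul, divV_apply, M2Of_apply, h2, one_smul, mixFFAt_inl_inl]

/-- [folklore] The left side vanishes on `(inl, inr)`. -/
theorem wardM_inl_inr (y : Fin (3 + 1) → ℤ) (ρ' : Fin (3 + 1)) (w x x' : Fin (3 + 1) → ℤ) (β μ : Fin (3 + 1)) :
    wardM Lc y ρ' w x x' (Sum.inl β) (Sum.inr μ) = 0 := by
  simp only [wardM, Pi.smul_apply, Finset.sum_apply, smul_eq_mul, divV_apply, M2Of_apply, mixFFAt_inl_inr,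
    sub_self, Finset.sum_const_zero, mul_zero]

/-- [folklore] The left side vanishes on `(inr, ·)`. -/
theorem wardM_inr (y : Fin (3 + 1) → ℤ) (ρ' : Fin (3 + 1)) (w x x' : Fin (3 + 1) → ℤ) (μ : Fin (3 + 1)) (b : Fib 3) :
    wardM Lc y ρ' w x x' (Sum.inr μ) b = 0 := by
  simp only [wardM, Pi.smul_apply, Finset.sum_apply, smul_eq_mul, divV_apply, M2Of_apply, mixFFAt_inr,
    sub_self, Finset.sum_const_zero, mul_zero]

omit [NeZero Lc] in
/-- [folklore] `M1At` at level `0` is `cΛ • hessFFAt` (`wM1 0 = 1`). -/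
theorem M1At_zero (cΛ : ℝ) (ρ' : Fin (3 + 1)) (w : Fin (3 + 1) → ℤ) :
    M1At 3 Lc (toSite (ctrOff 4 Lc)) cΛ 0 ρ' w = cΛ • hessFFAt (toSite (ctrOff 4 Lc)) Lc ρ' w := by
  have h : wM1 3 Lc 0 = 1 := by simp [BalabanStepW2.wM1]
  simp only [M1At, h, mul_one]

/-- [folklore] The datum entrywise: `cΛ · hessFFAt … x x′ a b · (D(x′,b) − D(x,a))`, `D := ½ Σ_v legInd ρ_c (Lc•y + v)`. -/
theorem datM_apply (cΛ : ℝ) (y : Fin (3 + 1) → ℤ) (ρ' : Fin (3 + 1)) (w x x' : Fin (3 + 1) → ℤ) (a b : Fib 3) :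
    datM Lc cΛ y ρ' w x x' a b =
      cΛ * hessFFAt (toSite (ctrOff 4 Lc)) Lc ρ' w x x' a b *
        ((((1 : ℝ) / 2) • ∑ v ∈ box (3 + 1) Lc, legInd (toSite (ctrOff 4 Lc)) ((Lc : ℤ) • y + toSite v)) x' b
          - (((1 : ℝ) / 2) • ∑ v ∈ box (3 + 1) Lc, legInd (toSite (ctrOff 4 Lc)) ((Lc : ℤ) • y + toSite v)) x a) := by
  simp only [datM, M1At_zero, Pi.sub_apply, comp_diagK_right, comp_diagK_left, Pi.smul_apply, smul_eq_mul]
  ring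

/-- [folklore] The field–field entries of the datum: `cΛ · h_{(ρ′,w)}(f,f′) · (D(x′) − D(x))` with `D(x) = ½ Σ_v [x = Lc•y + v]`. -/
theorem datM_inl_inl (cΛ : ℝ) (y : Fin (3 + 1) → ℤ) (ρ' : Fin (3 + 1)) (w x x' : Fin (3 + 1) → ℤ) (β β' : Fin (3 + 1)) :
    datM Lc cΛ y ρ' w x x' (Sum.inl β) (Sum.inl β') =
      cΛ * hessKerAt (toSite (ctrOff 4 Lc)) Lc ρ' w (β, x) (β', x') *
        ((1 / 2 : ℝ) * (∑ v ∈ box (3 + 1) Lc, (if x' = (Lc : ℤ) • y + toSite v then (1 : ℝ) else 0))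
          - (1 / 2 : ℝ) * (∑ v ∈ box (3 + 1) Lc, (if x = (Lc : ℤ) • y + toSite v then (1 : ℝ) else 0))) := by
  rw [datM_apply, hessFFAt_inl_inl]
  simp only [Pi.smul_apply, Finset.sum_apply, smul_eq_mul, legInd_inl]

/-- [folklore] The datum vanishes on `(inl, inr)`. -/
theorem datM_inl_inr (cΛ : ℝ) (y : Fin (3 + 1) → ℤ) (ρ' : Fin (3 + 1)) (w x x' : Fin (3 + 1) → ℤ) (β μ : Fin (3 + 1)) :
    datM Lc cΛ y ρ' w x x' (Sum.inl β) (Sum.inr μ) = 0 := by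
  rw [datM_apply, hessFFAt_inl_inr]; ring

/-- [folklore] The datum vanishes on `(inr, ·)`. -/
theorem datM_inr (cΛ : ℝ) (y : Fin (3 + 1) → ℤ) (ρ' : Fin (3 + 1)) (w x x' : Fin (3 + 1) → ℤ) (μ : Fin (3 + 1)) (b : Fib 3) :
    datM Lc cΛ y ρ' w x x' (Sum.inr μ) b = 0 := by
  rw [datM_apply, hessFFAt_inr]; ring

/-- [folklore] The residual entrywise. -/
theorem RWof_apply (cΛ : ℝ) (y : Fin (3 + 1) → ℤ) (ρ' : Fin (3 + 1)) (w x x' : Fin (3 + 1) → ℤ) (a b : Fib 3) :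
    RWof Lc cΛ y ρ' w x x' a b = wardM Lc y ρ' w x x' a b - datM Lc cΛ y ρ' w x x' a b := rfl

/-! ## §3 The bond-level Ward law and the parity of the residual -/
/-- [folklore] **(WM-bond) ⟹ `RWof` IS ROW-PARITY-ODD** (`trK = −sgnK`).  (WM-bond): for every coarse site `y`, coarse bond `(ρ′,w)` and fine bonds
`f = (β,x)`, `f′ = (β′,x′)`, the `f ↔ f′`-symmetrisation of the block divergence of an1's mixed table equals TWICE the commutator datum:
`Lc⁻⁴·Σ_{v,κ} [(t(f,f′;κ,s_v−e_κ) − t(f,f′;κ,s_v)) + (t(f′,f;κ,s_v−e_κ) − t(f′,f;κ,s_v))] = 2·cΛ·h(f,f′)·(D(x′) − D(x))` (`t = mixKerAt`, `h = hessKerAt`,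
`D(x) = ½Σ_v [x = s_v]`).  On the field–field block this is exactly antisymmetry of `wardM − datM` (the datum is symmetric: `h` and `D(x′) − D(x)` are both
antisymmetric); off it both sides vanish. -/
theorem parityOdd_RWof_of_bondLaw (cΛ : ℝ)
    (hWM : ∀ (y : Fin (3 + 1) → ℤ) (ρ' : Fin (3 + 1)) (w : Fin (3 + 1) → ℤ) (β : Fin (3 + 1)) (x : Fin (3 + 1) → ℤ) (β' : Fin (3 + 1))
      (x' : Fin (3 + 1) → ℤ),
      ((Lc : ℝ) ^ (3 + 1))⁻¹ * (∑ v ∈ box (3 + 1) Lc, ∑ κ : Fin (3 + 1),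
          ((mixKerAt (toSite (ctrOff 4 Lc)) Lc ρ' w (κ, (Lc : ℤ) • y + toSite v - unitVec κ) (β, x) (β', x')
              - mixKerAt (toSite (ctrOff 4 Lc)) Lc ρ' w (κ, (Lc : ℤ) • y + toSite v) (β, x) (β', x'))
            + (mixKerAt (toSite (ctrOff 4 Lc)) Lc ρ' w (κ, (Lc : ℤ) • y + toSite v - unitVec κ) (β', x') (β, x)
              - mixKerAt (toSite (ctrOff 4 Lc)) Lc ρ' w (κ, (Lc : ℤ) • y + toSite v) (β', x') (β, x)))) =
        2 * (cΛ * hessKerAt (toSite (ctrOff 4 Lc)) Lc ρ' w (β, x) (β', x') *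
          ((1 / 2 : ℝ) * (∑ v ∈ box (3 + 1) Lc, (if x' = (Lc : ℤ) • y + toSite v then (1 : ℝ) else 0))
            - (1 / 2 : ℝ) * (∑ v ∈ box (3 + 1) Lc, (if x = (Lc : ℤ) • y + toSite v then (1 : ℝ) else 0))))) :
    ∀ (y : Fin (3 + 1) → ℤ) (ρ' : Fin (3 + 1)) (w : Fin (3 + 1) → ℤ), trK (RWof Lc cΛ y ρ' w) = -sgnK (RWof Lc cΛ y ρ' w) := by
  intro y ρ' w
  funext x x' a b
  simp only [trK_apply, Pi.neg_apply, sgnK_apply]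
  rcases a with β | μ <;> rcases b with β' | μ'
  · -- field–field: antisymmetry from the bond law
    have h := hWM y ρ' w β' x' β x
    rw [BorderedHessian.sgnF_inl, BorderedHessian.sgnF_inl, one_mul, one_mul, RWof_apply, RWof_apply, wardM_inl_inl, wardM_inl_inl, datM_inl_inl,
      datM_inl_inl, hessKerAt_swap (toSite (ctrOff 4 Lc)) Lc ρ' w (β, x) (β', x')]
    rw [hessKerAt_swap (toSite (ctrOff 4 Lc)) Lc ρ' w (β, x) (β', x')] at h
    have hsplit : ((Lc : ℝ) ^ (3 + 1))⁻¹ * (∑ v ∈ box (3 + 1) Lc, ∑ κ : Fin (3 + 1),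
          ((mixKerAt (toSite (ctrOff 4 Lc)) Lc ρ' w (κ, (Lc : ℤ) • y + toSite v - unitVec κ) (β', x') (β, x)
              - mixKerAt (toSite (ctrOff 4 Lc)) Lc ρ' w (κ, (Lc : ℤ) • y + toSite v) (β', x') (β, x))
            + (mixKerAt (toSite (ctrOff 4 Lc)) Lc ρ' w (κ, (Lc : ℤ) • y + toSite v - unitVec κ) (β, x) (β', x')
              - mixKerAt (toSite (ctrOff 4 Lc)) Lc ρ' w (κ, (Lc : ℤ) • y + toSite v) (β, x) (β', x')))) =
        ((Lc : ℝ) ^ (3 + 1))⁻¹ * ∑ v ∈ box (3 + 1) Lc, ∑ κ : Fin (3 + 1),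
          (mixKerAt (toSite (ctrOff 4 Lc)) Lc ρ' w (κ, (Lc : ℤ) • y + toSite v - unitVec κ) (β', x') (β, x)
              - mixKerAt (toSite (ctrOff 4 Lc)) Lc ρ' w (κ, (Lc : ℤ) • y + toSite v) (β', x') (β, x))
        + ((Lc : ℝ) ^ (3 + 1))⁻¹ * ∑ v ∈ box (3 + 1) Lc, ∑ κ : Fin (3 + 1),
            (mixKerAt (toSite (ctrOff 4 Lc)) Lc ρ' w (κ, (Lc : ℤ) • y + toSite v - unitVec κ) (β, x) (β', x')
              - mixKerAt (toSite (ctrOff 4 Lc)) Lc ρ' w (κ, (Lc : ℤ) • y + toSite v) (β, x) (β', x')) := by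
      rw [← mul_add, ← Finset.sum_add_distrib]
      congr 1
      refine Finset.sum_congr rfl fun v _ => ?_
      rw [← Finset.sum_add_distrib]
    rw [hsplit] at h
    linarith
  · rw [RWof_apply, RWof_apply, wardM_inl_inr, datM_inl_inr, wardM_inr, datM_inr]; ring
  · rw [RWof_apply, RWof_apply, wardM_inl_inr, datM_inl_inr, wardM_inr, datM_inr]; ring
  · rw [RWof_apply, RWof_apply, wardM_inr, datM_inr, wardM_inr, datM_inr]; ring

/-! ## §4 The residual is a vertex family, constants uniform in the coarse site (no hypothesis) -/

section Class

/-- [folklore] **ABSORBING A FAR FACTOR**: a kernel bi-localised at `(u,u)` with constant `C·e^{−δ|u−c|}` is bi-localised at `(c,c)` with constant `C`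
at rate `δ∕2` (triangle inequality twice). -/
theorem biLoc_absorb {d : ℕ} {K : MKer (d + 1) (Fib d)} {u c : Fin (d + 1) → ℤ} {C δ : ℝ} (hC : 0 ≤ C) (hδ : 0 ≤ δ)
    (h : BiLoc K u u (C * Real.exp (-δ * l1 (u - c))) δ) : BiLoc K c c C (δ / 2) := by
  intro x z a b
  refine (h x z a b).trans ?_
  rw [mul_assoc]
  refine mul_le_mul_of_nonneg_left ?_ hC
  rw [← Real.exp_add, Real.exp_le_exp]
  have tx := l1_sub_triangle x u c
  have tz := l1_sub_triangle z u c
  nlinarith [l1_nonneg (x - u), l1_nonneg (z - u), l1_nonneg (u - c), l1_nonneg (x - c), l1_nonneg (z - c)]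

omit [NeZero Lc] in
/-- [folklore] an1's mixed table, any bond `u`, is bi-localised at the coarse point `Lc•w` (rate `1∕2`, constant `mixAbs·e^{6·4·Lc}`). -/
theorem biLoc_mixFFAt_coarse (hLc : 1 ≤ Lc) (κ : Fin (3 + 1)) (u : Fin (3 + 1) → ℤ) (ρ' : Fin (3 + 1)) (w : Fin (3 + 1) → ℤ) :
    BiLoc (mixFFAt (toSite (ctrOff 4 Lc)) Lc κ u ρ' w) ((Lc : ℤ) • w) ((Lc : ℤ) • w)
      (mixAbs (toSite (ctrOff 4 Lc)) Lc * Real.exp (6 * ((3 : ℝ) + 1) * Lc * 1)) (1 / 2) := by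
  have h := biLoc_mixFFAt (d := 3) hLc (ctrOff_mem_box (d := 4) hLc) zero_le_one κ u ρ' w
  exact biLoc_absorb (mul_nonneg (mixAbs_nonneg _ _) (Real.exp_pos _).le) zero_le_one (by simpa using h)

/-- [folklore] **THE LEFT SIDE IS A VERTEX FAMILY** with constants uniform in `y`: every one of the `2·4·|box|` terms of the block divergence is a
table `mixFFAt κ u ρ′ w` bi-localised at `Lc•w` (`biLoc_mixFFAt_coarse`). -/
theorem vertexFamily_wardM (hLc : 1 ≤ Lc) (y : Fin (3 + 1) → ℤ) :
    VertexFamily (wardM Lc y) Lc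
      (|(stepScale 3 Lc 0 * (Lc : ℝ) ^ (3 + 1))⁻¹| *
        ∑ _v ∈ box (3 + 1) Lc, ∑ _κ : Fin (3 + 1), (mixAbs (toSite (ctrOff 4 Lc)) Lc * Real.exp (6 * ((3 : ℝ) + 1) * Lc * 1)
          + mixAbs (toSite (ctrOff 4 Lc)) Lc * Real.exp (6 * ((3 : ℝ) + 1) * Lc * 1))) (1 / 2) := by
  intro ρ' w
  have h2 : wM2 3 Lc 0 = 1 := by simp [BalabanStepW2.wM2]
  have hsum : BiLoc (fun x z a b => ∑ v ∈ box (3 + 1) Lc,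
      divV (fun κ u => M2Of 3 Lc (mixFFAt (toSite (ctrOff 4 Lc)) Lc) 0 κ u ρ' w) ((Lc : ℤ) • y + toSite v) x z a b)
      ((Lc : ℤ) • w) ((Lc : ℤ) • w)
      (∑ _v ∈ box (3 + 1) Lc, ∑ _κ : Fin (3 + 1), (mixAbs (toSite (ctrOff 4 Lc)) Lc * Real.exp (6 * ((3 : ℝ) + 1) * Lc * 1)
          + mixAbs (toSite (ctrOff 4 Lc)) Lc * Real.exp (6 * ((3 : ℝ) + 1) * Lc * 1))) (1 / 2) := by
    refine biLoc_finset_sum (box (3 + 1) Lc) fun v _ => ?_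
    have e : divV (fun κ u => M2Of 3 Lc (mixFFAt (toSite (ctrOff 4 Lc)) Lc) 0 κ u ρ' w) ((Lc : ℤ) • y + toSite v)
        = fun x z a b => ∑ κ : Fin (3 + 1), (mixFFAt (toSite (ctrOff 4 Lc)) Lc κ ((Lc : ℤ) • y + toSite v - unitVec κ) ρ' w
            - mixFFAt (toSite (ctrOff 4 Lc)) Lc κ ((Lc : ℤ) • y + toSite v) ρ' w) x z a b := by
      funext x z a b
      rw [divV_apply]
      refine Finset.sum_congr rfl fun κ _ => ?_
      simp only [M2Of_apply, h2, one_smul, Pi.sub_apply]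
    rw [e]
    refine biLoc_finset_sum (Finset.univ : Finset (Fin (3 + 1))) fun κ _ => ?_
    exact biLoc_sub (biLoc_mixFFAt_coarse hLc κ _ ρ' w) (biLoc_mixFFAt_coarse hLc κ _ ρ' w)
  have hs := biLoc_smul hsum ((stepScale 3 Lc 0 * (Lc : ℝ) ^ (3 + 1))⁻¹)
  refine biLoc_weaken (K := wardM Lc y ρ' w) ?_ le_rfl le_rfl
  intro x z a b
  have hx := hs x z a b
  have ew : wardM Lc y ρ' w x z a b = ((stepScale 3 Lc 0 * (Lc : ℝ) ^ (3 + 1))⁻¹ •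
      fun x z a b => ∑ v ∈ box (3 + 1) Lc,
        divV (fun κ u => M2Of 3 Lc (mixFFAt (toSite (ctrOff 4 Lc)) Lc) 0 κ u ρ' w) ((Lc : ℤ) • y + toSite v) x z a b) x z a b := by
    simp only [wardM, Pi.smul_apply, Finset.sum_apply]
  rw [ew]
  exact hx

omit [NeZero Lc] in
/-- [folklore] The half-indicator symbol `D_y = ½ Σ_v legInd ρ_c (Lc•y + v)` is bounded by `½·|box|`. -/
theorem abs_D_le (y z : Fin (3 + 1) → ℤ) (b : Fib 3) :
    |(((1 : ℝ) / 2) • ∑ v ∈ box (3 + 1) Lc, legInd (toSite (ctrOff 4 Lc)) ((Lc : ℤ) • y + toSite v)) z b|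
      ≤ (1 / 2 : ℝ) * (box (3 + 1) Lc).card := by
  simp only [Pi.smul_apply, Finset.sum_apply, smul_eq_mul]
  rw [abs_mul, abs_of_pos (by norm_num : (0 : ℝ) < 1 / 2)]
  refine mul_le_mul_of_nonneg_left ?_ (by norm_num)
  calc |∑ v ∈ box (3 + 1) Lc, legInd (toSite (ctrOff 4 Lc)) ((Lc : ℤ) • y + toSite v) z b|
      ≤ ∑ v ∈ box (3 + 1) Lc, |legInd (toSite (ctrOff 4 Lc)) ((Lc : ℤ) • y + toSite v) z b| := Finset.abs_sum_le_sum_abs _ _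
    _ ≤ ∑ _v ∈ box (3 + 1) Lc, (1 : ℝ) := Finset.sum_le_sum fun v _ => by
        rw [legInd_apply]; split_ifs <;> simp
    _ = (box (3 + 1) Lc).card := by simp

/-- [folklore] **THE DATUM IS A VERTEX FAMILY** with constants uniform in `y`: `hessFFAt … ρ′ w` is bi-localised at `Lc•w` (an1's `biLoc_hessFFAt`) and the
symbol `D_y` is bounded by `½·|box|`. -/
theorem vertexFamily_datM (hLc : 1 ≤ Lc) (cΛ : ℝ) (y : Fin (3 + 1) → ℤ) :
    VertexFamily (datM Lc cΛ y) Lc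
      (|cΛ| * (2 * (ell (3 + 1) Lc : ℝ) ^ 2 * Real.exp (4 * ((3 : ℝ) + 1) * Lc * (1 / 2))) * (2 * ((1 / 2 : ℝ) * (box (3 + 1) Lc).card))) (1 / 2) := by
  intro ρ' w x z a b
  have hH := biLoc_hessFFAt (d := 3) hLc ρ' w (ctrOff_mem_box (d := 4) hLc) (by norm_num : (0 : ℝ) ≤ 1 / 2) x z a b
  have hD1 := abs_D_le (Lc := Lc) y z b
  have hD2 := abs_D_le (Lc := Lc) y x a
  rw [datM_apply, abs_mul, abs_mul]
  have hdiff : |(((1 : ℝ) / 2) • ∑ v ∈ box (3 + 1) Lc, legInd (toSite (ctrOff 4 Lc)) ((Lc : ℤ) • y + toSite v)) z b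
      - (((1 : ℝ) / 2) • ∑ v ∈ box (3 + 1) Lc, legInd (toSite (ctrOff 4 Lc)) ((Lc : ℤ) • y + toSite v)) x a|
      ≤ 2 * ((1 / 2 : ℝ) * (box (3 + 1) Lc).card) := by
    refine (abs_sub _ _).trans ?_
    linarith
  have hC : 0 ≤ 2 * (ell (3 + 1) Lc : ℝ) ^ 2 * Real.exp (4 * ((3 : ℝ) + 1) * Lc * (1 / 2)) := by positivity
  calc |cΛ| * |hessFFAt (toSite (ctrOff 4 Lc)) Lc ρ' w x z a b| *
        |(((1 : ℝ) / 2) • ∑ v ∈ box (3 + 1) Lc, legInd (toSite (ctrOff 4 Lc)) ((Lc : ℤ) • y + toSite v)) z b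
          - (((1 : ℝ) / 2) • ∑ v ∈ box (3 + 1) Lc, legInd (toSite (ctrOff 4 Lc)) ((Lc : ℤ) • y + toSite v)) x a|
      ≤ |cΛ| * (2 * (ell (3 + 1) Lc : ℝ) ^ 2 * Real.exp (4 * ((3 : ℝ) + 1) * Lc * (1 / 2))
          * Real.exp (-(1 / 2) * (l1 (x - (Lc : ℤ) • w) + l1 (z - (Lc : ℤ) • w)))) * (2 * ((1 / 2 : ℝ) * (box (3 + 1) Lc).card)) := by
        refine mul_le_mul (mul_le_mul_of_nonneg_left hH (abs_nonneg _)) hdiff (abs_nonneg _) ?_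
        exact mul_nonneg (abs_nonneg _) (mul_nonneg hC (Real.exp_pos _).le)
    _ = _ := by ring

/-- [folklore] **THE RESIDUAL IS A VERTEX FAMILY, CONSTANTS UNIFORM IN THE COARSE SITE** — the END's binder `hclsW₀` for `RW₀ := RWof Lc cΛ`, with
NO hypothesis (finite-range tables). -/
theorem vertexFamily_RWof (hLc : 1 ≤ Lc) (cΛ : ℝ) : ∃ C δ : ℝ, 0 < δ ∧ ∀ y, VertexFamily (RWof Lc cΛ y) Lc C δ := by
  refine ⟨|(stepScale 3 Lc 0 * (Lc : ℝ) ^ (3 + 1))⁻¹| *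
        ∑ _v ∈ box (3 + 1) Lc, ∑ _κ : Fin (3 + 1), (mixAbs (toSite (ctrOff 4 Lc)) Lc * Real.exp (6 * ((3 : ℝ) + 1) * Lc * 1)
          + mixAbs (toSite (ctrOff 4 Lc)) Lc * Real.exp (6 * ((3 : ℝ) + 1) * Lc * 1))
      + |cΛ| * (2 * (ell (3 + 1) Lc : ℝ) ^ 2 * Real.exp (4 * ((3 : ℝ) + 1) * Lc * (1 / 2))) * (2 * ((1 / 2 : ℝ) * (box (3 + 1) Lc).card)),
    1 / 2, by norm_num, fun y ρ' w => ?_⟩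
  have h := biLoc_sub (vertexFamily_wardM hLc y ρ' w) (vertexFamily_datM hLc cΛ y ρ' w)
  exact h

end Class

/-! ## §5 The three mixed Ward binders of the row END from the bond-level law -/
/-- [folklore] **(WM-bond) ⟹ THE THREE MIXED WARD BINDERS** (`hclsW₀`, `hRW₀p`, `hM₂0`) of `RowD1JointEnd.symmetries_JsRowD1_of_letters` ∕
`…_JsRowD1Pin_…` with `RW₀ := RWof Lc cΛ`.  CONDITIONAL on the bond-level Ward law of an1's mixed table (a HYPOTHESIS; ENGINE-W evidence only). -/
theorem mixedWardBinders_of_bondLaw (hLc : 1 ≤ Lc) (cΛ : ℝ)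
    (hWM : ∀ (y : Fin (3 + 1) → ℤ) (ρ' : Fin (3 + 1)) (w : Fin (3 + 1) → ℤ) (β : Fin (3 + 1)) (x : Fin (3 + 1) → ℤ) (β' : Fin (3 + 1))
      (x' : Fin (3 + 1) → ℤ),
      ((Lc : ℝ) ^ (3 + 1))⁻¹ * (∑ v ∈ box (3 + 1) Lc, ∑ κ : Fin (3 + 1),
          ((mixKerAt (toSite (ctrOff 4 Lc)) Lc ρ' w (κ, (Lc : ℤ) • y + toSite v - unitVec κ) (β, x) (β', x')
              - mixKerAt (toSite (ctrOff 4 Lc)) Lc ρ' w (κ, (Lc : ℤ) • y + toSite v) (β, x) (β', x'))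
            + (mixKerAt (toSite (ctrOff 4 Lc)) Lc ρ' w (κ, (Lc : ℤ) • y + toSite v - unitVec κ) (β', x') (β, x)
              - mixKerAt (toSite (ctrOff 4 Lc)) Lc ρ' w (κ, (Lc : ℤ) • y + toSite v) (β', x') (β, x)))) =
        2 * (cΛ * hessKerAt (toSite (ctrOff 4 Lc)) Lc ρ' w (β, x) (β', x') *
          ((1 / 2 : ℝ) * (∑ v ∈ box (3 + 1) Lc, (if x' = (Lc : ℤ) • y + toSite v then (1 : ℝ) else 0))
            - (1 / 2 : ℝ) * (∑ v ∈ box (3 + 1) Lc, (if x = (Lc : ℤ) • y + toSite v then (1 : ℝ) else 0))))) :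
    (∃ C δ : ℝ, 0 < δ ∧ ∀ y, VertexFamily (RWof Lc cΛ y) Lc C δ)
      ∧ (∀ y ρ' w, trK (RWof Lc cΛ y ρ' w) = -sgnK (RWof Lc cΛ y ρ' w))
      ∧ (∀ (y : Fin (3 + 1) → ℤ) (ρ' : Fin (3 + 1)) (w : Fin (3 + 1) → ℤ),
          (stepScale 3 Lc 0 * (Lc : ℝ) ^ (3 + 1))⁻¹ • ∑ v ∈ box (3 + 1) Lc,
              divV (fun κ u => M2Of 3 Lc (mixFFAt (toSite (ctrOff 4 Lc)) Lc) 0 κ u ρ' w) ((Lc : ℤ) • y + toSite v) =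
            comp (M1At 3 Lc (toSite (ctrOff 4 Lc)) cΛ 0 ρ' w)
                (diagK (((1 : ℝ) / 2) • ∑ v ∈ box (3 + 1) Lc, legInd (toSite (ctrOff 4 Lc)) ((Lc : ℤ) • y + toSite v)))
              - comp (diagK (((1 : ℝ) / 2) • ∑ v ∈ box (3 + 1) Lc, legInd (toSite (ctrOff 4 Lc)) ((Lc : ℤ) • y + toSite v)))
                (M1At 3 Lc (toSite (ctrOff 4 Lc)) cΛ 0 ρ' w)
              + RWof Lc cΛ y ρ' w) :=
  ⟨vertexFamily_RWof hLc cΛ, parityOdd_RWof_of_bondLaw cΛ hWM, wardMixed_RWof cΛ⟩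


/-! ## §6 The row's symmetry binders with the mixed Ward letter replaced by its bond-level law -/

/-- [folklore] **hW ∧ hR FOR THE PINNED LITERAL `JsRowD1Pin` ⟸ hM ∧ hInv ∧ hBord0 ∧ hBord0″ ∧ (WM-bond)** — `RowD1JointEnd.symmetries_JsRowD1Pin_of_letters`
with its three mixed Ward binders supplied by `mixedWardBinders_of_bondLaw` at `cΛ := 2∕Lc⁴` (`RW₀ := RWof Lc (2∕Lc⁴)`).  CONDITIONAL on the four remaining
displayed identities; a plumbing check that the packed binders are the END's VERBATIM. -/
theorem symmetries_JsRowD1Pin_of_letters_bondWard (hLc : Odd Lc) {N : ℕ} (hN : 2 ≤ N)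
    (γ : ℕ → ℝ) (hγ : ∀ j, γ j = -((Lc : ℝ) ^ 8 / 2) * wVH 3 Lc j / (stepScale 3 Lc j * (Lc : ℝ) ^ 4))
    (hM : ∀ (α κ : Fin 4) (u : Fin 4 → ℤ) (ρ' : Fin 4) (w : Fin 4 → ℤ),
      mixFFAt (toSite (ctrOff 4 Lc)) Lc κ (bref α κ u) ρ' (bref α ρ' w) =
        (reflSign α κ * reflSign α ρ') • refK (Φ Lc α)
          (mixFFAt (toSite (ctrOff 4 Lc)) Lc κ u ρ' w
            + (2 : ℝ) • comp (diagK (ctGen 3 α Lc κ u)) (hessFFAt (toSite (ctrOff 4 Lc)) Lc ρ' w)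
            + (2 * (if ρ' = α then linKerAt (toSite (ctrOff 4 Lc)) Lc ρ' w (κ, u) else 0)) • hessFFAt (toSite (ctrOff 4 Lc)) Lc ρ' w))
    (hInv : ∀ (α κ : Fin 4) (u : Fin 4 → ℤ) (κ' : Fin 4) (u' x z : Fin 4 → ℤ) (β m : Fin 4),
      (actB Lc α ((-((Lc : ℝ) ^ 12 / 4)) • vh₂SAn1 Lc - Twall Lc (2 / (Lc : ℝ) ^ 4) γ)
        - ((-((Lc : ℝ) ^ 12 / 4)) • vh₂SAn1 Lc - Twall Lc (2 / (Lc : ℝ) ^ 4) γ)) κ u κ' u' x z (Sum.inl β) (Sum.inr m) = 0)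
    (hBord0 : ∀ (Y : Fin (3 + 1) → ℤ) (κ' : Fin (3 + 1)) (u' : Fin (3 + 1) → ℤ),
      (stepScale 3 Lc 0 * (Lc : ℝ) ^ (3 + 1))⁻¹ • ∑ v ∈ box (3 + 1) Lc, divV (fun κ u => (-((Lc : ℝ) ^ 12 / 4)) • vh₂SAn1 Lc κ u κ' u') ((Lc : ℤ) • Y + toSite v) =
        comp ((-((Lc : ℝ) ^ (3 + 1) * (1 / 2) * (Lc : ℝ) ^ (3 + 1))) • vhSAt (toSite (ctrOff 4 Lc)) 3 Lc rfl κ' u') (diagK (((1 : ℝ) / 2) • ∑ v ∈ box (3 + 1) Lc, legInd (toSite (ctrOff 4 Lc)) ((Lc : ℤ) • Y + toSite v)))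
          - comp (diagK (((1 : ℝ) / 2) • ∑ v ∈ box (3 + 1) Lc, legInd (toSite (ctrOff 4 Lc)) ((Lc : ℤ) • Y + toSite v))) ((-((Lc : ℝ) ^ (3 + 1) * (1 / 2) * (Lc : ℝ) ^ (3 + 1))) • vhSAt (toSite (ctrOff 4 Lc)) 3 Lc rfl κ' u'))
    (hBord0'' : ∀ (Y : Fin (3 + 1) → ℤ) (κ : Fin (3 + 1)) (u : Fin (3 + 1) → ℤ),
      (stepScale 3 Lc 0 * (Lc : ℝ) ^ (3 + 1))⁻¹ • ∑ v ∈ box (3 + 1) Lc, divV (fun κ' u' => (-((Lc : ℝ) ^ 12 / 4)) • vh₂SAn1 Lc κ u κ' u') ((Lc : ℤ) • Y + toSite v) =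
        comp ((-((Lc : ℝ) ^ (3 + 1) * (1 / 2) * (Lc : ℝ) ^ (3 + 1))) • vhSAt (toSite (ctrOff 4 Lc)) 3 Lc rfl κ u) (diagK (((1 : ℝ) / 2) • ∑ v ∈ box (3 + 1) Lc, legInd (toSite (ctrOff 4 Lc)) ((Lc : ℤ) • Y + toSite v)))
          - comp (diagK (((1 : ℝ) / 2) • ∑ v ∈ box (3 + 1) Lc, legInd (toSite (ctrOff 4 Lc)) ((Lc : ℤ) • Y + toSite v))) ((-((Lc : ℝ) ^ (3 + 1) * (1 / 2) * (Lc : ℝ) ^ (3 + 1))) • vhSAt (toSite (ctrOff 4 Lc)) 3 Lc rfl κ u))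
    (hWM : ∀ (y : Fin (3 + 1) → ℤ) (ρ' : Fin (3 + 1)) (w : Fin (3 + 1) → ℤ) (β : Fin (3 + 1)) (x : Fin (3 + 1) → ℤ) (β' : Fin (3 + 1))
      (x' : Fin (3 + 1) → ℤ),
      ((Lc : ℝ) ^ (3 + 1))⁻¹ * (∑ v ∈ box (3 + 1) Lc, ∑ κ : Fin (3 + 1),
          ((mixKerAt (toSite (ctrOff 4 Lc)) Lc ρ' w (κ, (Lc : ℤ) • y + toSite v - unitVec κ) (β, x) (β', x')
              - mixKerAt (toSite (ctrOff 4 Lc)) Lc ρ' w (κ, (Lc : ℤ) • y + toSite v) (β, x) (β', x'))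
            + (mixKerAt (toSite (ctrOff 4 Lc)) Lc ρ' w (κ, (Lc : ℤ) • y + toSite v - unitVec κ) (β', x') (β, x)
              - mixKerAt (toSite (ctrOff 4 Lc)) Lc ρ' w (κ, (Lc : ℤ) • y + toSite v) (β', x') (β, x)))) =
        2 * ((2 / (Lc : ℝ) ^ 4) * hessKerAt (toSite (ctrOff 4 Lc)) Lc ρ' w (β, x) (β', x') *
          ((1 / 2 : ℝ) * (∑ v ∈ box (3 + 1) Lc, (if x' = (Lc : ℤ) • y + toSite v then (1 : ℝ) else 0))
            - (1 / 2 : ℝ) * (∑ v ∈ box (3 + 1) Lc, (if x = (Lc : ℤ) • y + toSite v then (1 : ℝ) else 0)))))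
 :
    (∀ j : ℕ, WardTransversal (flipK (TbalOf Lc (JsRowD1Pin hLc N) j)))
      ∧ (∀ j : ℕ, AxisReflectionCovariant (flipK (TbalOf Lc (JsRowD1Pin hLc N) j))) := by
  obtain ⟨hcls, hpar, hM₂0⟩ := mixedWardBinders_of_bondLaw (Lc := Lc) hLc.pos (2 / (Lc : ℝ) ^ 4) hWM
  exact symmetries_JsRowD1Pin_of_letters hLc hN γ hγ hM hInv hcls hpar hBord0 hBord0'' hM₂0

end

end Summit.QuantumFields.BalabanUV.Beta.MixedWardPacking
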